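import Literature.Geometry.Riemannian.CurveTubeMap
import Literature.Geometry.Riemannian.MetricComponentsInverse
import Mathlib.Topology.MetricSpace.Thickening
import HarnessLib

/-!
# The tube metric near the axis is uniformly close to the inner product

Topic `Geometry/Riemannian`. For the tube map `Φ` of a curve with a `g`-orthonormal adapted frame
(`CurveTubeMap.lean`) the pulled-back metric is the inner product ON the axis
(`val_mfderiv_tubeMap_axis`, Lee 2018 Prop. 5.26 (b)). If `g_U` is a chart metric on
`U : Opens V` whose components `G_U` agree with the pulled-back form on an open `W ⊆ U`
containing the compact axis segment `{x₁ ε₀ : a ≤ x₁ ≤ b}`, then (uniform continuity of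
`(x, Y) ↦ G_U(x)(Y, Y)` on a compact neighbourhood, scaling in `Y`) **for every `η > 0` there is
`δ > 0` with `(1 - η)‖Y‖² ≤ G_U(x)(Y, Y) ≤ (1 + η)‖Y‖²` for all `x ∈ U` with `⟪ε₀, x⟫ ∈ [a, b]`,
`‖x - ⟪ε₀, x⟫ε₀‖ < δ` and all `Y`** (`exists_tube_metric_near_inner`). This is the comparability
of norms used to convert the Christoffel bound of `TubeChristoffelNearAxis.lean` into the
second-fundamental-form bound of Weinstein's thin ellipsoid (Weinstein 1968, proof of the main
theorem, step (2)).

## References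

* J. M. Lee, *Introduction to Riemannian Manifolds*, 2nd ed. (2018), Prop. 5.26.
  [cite: LeeRiemannianManifolds2018, Prop. 5.26]
* A. Weinstein, Ann. of Math. (2) 87 (1968), 29–41. [cite: Weinstein1968]

Tags: [FermiCoordinates] [Weinstein1968]
-/

noncomputable section

open Bundle Set Filter Function InnerProductSpace TopologicalSpace Metric
open scoped Manifold ContDiff Topology RealInnerProductSpace

namespace Literature.Geometry.Riemannian

open Literature.Geometry.Lorentzian
open Literature.Geometry.Lorentzian.OpensChart

/-- **Continuity of `(x, Y) ↦ G_U(x)(Y, Y)`** on `U × V` for a chart metric. [folklore] -/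
theorem continuous_metricComponents_apply_self {V : Type*} [NormedAddCommGroup V]
    [NormedSpace ℝ V] {U : Opens V} {m : ℕ∞ω}
    (gU : PseudoRiemannianMetric 𝓘(ℝ, V) m V (TangentSpace 𝓘(ℝ, V) : U → Type _))
    (GU : V → V →L[ℝ] V →L[ℝ] ℝ) (hG : ∀ y : U, gU.val y = GU y) :
    Continuous (fun q : U × V ↦ GU q.1 q.2 q.2) := by
  have h1 : Continuous fun q : U × V ↦ GU q.1 := by
    rw [continuous_iff_continuousAt]
    intro q
    exact ((contDiffAt_metricComponents gU GU hG q.1).continuousAt.comp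
      continuous_subtype_val.continuousAt).comp continuous_fst.continuousAt
  exact (h1.clm_apply continuous_snd).clm_apply continuous_snd

variable {V : Type*} [NormedAddCommGroup V] [InnerProductSpace ℝ V] [FiniteDimensional ℝ V]
  {E : Type*} [NormedAddCommGroup E] [NormedSpace ℝ E] {H : Type*} [TopologicalSpace H]
  {I : ModelWithCorners ℝ E H} {M : Type*} [TopologicalSpace M] [ChartedSpace H M]
  [IsManifold I ∞ M] [FiniteDimensional ℝ E] [CompleteSpace E] [T2Space M] [BoundarylessManifold I M]
  {n : ℕ∞ω} [Fact (1 ≤ n)]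
  (g : PseudoRiemannianMetric I n E (TangentSpace I : M → Type _)) [g.HasLeviCivita]
  [CovariantDerivative.ContMDiffCovariantDerivative g.leviCivita 1]
  [CovariantDerivative.ContMDiffCovariantDerivative g.leviCivita ((⊤ : ℕ∞) : ℕ∞ω)]
  {c : ℝ → M} {e : Π t : ℝ, V →L[ℝ] TangentSpace I (c t)} {ε₀ : V}
  {U : Opens V} {m : ℕ∞ω}
  (gU : PseudoRiemannianMetric 𝓘(ℝ, V) m V (TangentSpace 𝓘(ℝ, V) : U → Type _))
  (GU : V → V →L[ℝ] V →L[ℝ] ℝ)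

omit [FiniteDimensional ℝ V] [FiniteDimensional ℝ E] [CompleteSpace E] [T2Space M]
  [BoundarylessManifold I M] [Fact (1 ≤ n)] [g.HasLeviCivita]
  [CovariantDerivative.ContMDiffCovariantDerivative g.leviCivita 1]
  [CovariantDerivative.ContMDiffCovariantDerivative g.leviCivita ((⊤ : ℕ∞) : ℕ∞ω)]
  [InnerProductSpace ℝ V] in
/-- Transport of a value of `g` along an equality of base points. [folklore] -/
private theorem val_congr_pt' {p p' : M} (h : p = p') (a b : E) : g.val p a b = g.val p' a b := by
  subst h
  rfl

set_option maxHeartbeats 400000 in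
omit [Fact (1 ≤ n)] in
/-- **The tube metric is `η`-close to the inner product on a thin tube around a compact axis
segment.** [cite: LeeRiemannianManifolds2018, Prop. 5.26] -/
theorem exists_tube_metric_near_inner (hgc : IsGeodesicallyComplete g.leviCivita)
    (hs : ContMDiff (𝓘(ℝ, ℝ).prod 𝓘(ℝ, V)) I.tangent ∞
      (fun q : ℝ × V ↦ (TotalSpace.mk' E (c q.1) (e q.1 q.2) : TangentBundle I M)))
    (hε₀ : ‖ε₀‖ = 1) (he₀ : ∀ t, e t ε₀ = (velocity I c t : E))
    (hiso : ∀ t (u w : V), g.val (c t) (e t u) (e t w) = ⟪u, w⟫)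
    (hG : ∀ y : U, gU.val y = GU y) {a b : ℝ}
    {W : Set V} (hW : IsOpen W) (hWU : W ⊆ (U : Set V)) (haxW : ∀ x₁ ∈ Icc a b, x₁ • ε₀ ∈ W)
    (hGU : ∀ v ∈ W, ∀ u w : V, GU v u w =
      g.val (expMap g.leviCivita (c ⟪ε₀, v⟫) (e ⟪ε₀, v⟫ (v - ⟪ε₀, v⟫ • ε₀)))
        (mfderiv 𝓘(ℝ, V) I (fun v : V ↦ expMap g.leviCivita (c ⟪ε₀, v⟫)
          (e ⟪ε₀, v⟫ (v - ⟪ε₀, v⟫ • ε₀))) v u)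
        (mfderiv 𝓘(ℝ, V) I (fun v : V ↦ expMap g.leviCivita (c ⟪ε₀, v⟫)
          (e ⟪ε₀, v⟫ (v - ⟪ε₀, v⟫ • ε₀))) v w))
    {η : ℝ} (hη : 0 < η) :
    ∃ δ : ℝ, 0 < δ ∧ ∀ x : U, ⟪ε₀, (x : V)⟫ ∈ Icc a b → ‖(x : V) - ⟪ε₀, (x : V)⟫ • ε₀‖ < δ →
      ∀ Y : V, (1 - η) * ‖Y‖ ^ 2 ≤ GU x Y Y ∧ GU x Y Y ≤ (1 + η) * ‖Y‖ ^ 2 := by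
  haveI : CompleteSpace V := FiniteDimensional.complete ℝ V
  have hcont := continuous_metricComponents_apply_self gU GU hG
  /- (1) a compact solid tube around the axis segment inside `W`, times the unit ball -/
  set Kax : Set V := (fun x₁ : ℝ ↦ x₁ • ε₀) '' Icc a b with hKax
  have hKaxc : IsCompact Kax := isCompact_Icc.image (continuous_id.smul continuous_const)
  have hKaxW : Kax ⊆ W := by rintro _ ⟨s, hs', rfl⟩; exact haxW s hs'
  obtain ⟨δ₀, hδ₀, hthick⟩ := hKaxc.exists_cthickening_subset_open hW hKaxW
  have htubeW : ∀ v : V, ⟪ε₀, v⟫ ∈ Icc a b → ‖v - ⟪ε₀, v⟫ • ε₀‖ ≤ δ₀ → v ∈ W := by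
    intro v hv hvr
    apply hthick
    rw [mem_cthickening_iff]
    refine le_trans (Metric.infEDist_le_edist_of_mem (⟨⟪ε₀, v⟫, hv, rfl⟩ : ⟪ε₀, v⟫ • ε₀ ∈ Kax)) ?_
    rw [edist_dist, dist_eq_norm]
    exact ENNReal.ofReal_le_ofReal hvr
  set C : Set (V × V) := {q | ⟪ε₀, q.1⟫ ∈ Icc a b ∧ ‖q.1 - ⟪ε₀, q.1⟫ • ε₀‖ ≤ δ₀ ∧ ‖q.2‖ ≤ 1}
    with hC
  have hCsub : ∀ q ∈ C, q.1 ∈ (U : Set V) := fun q hq ↦ hWU (htubeW q.1 hq.1 hq.2.1)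
  have hCc : IsCompact C := by
    haveI : ProperSpace V := FiniteDimensional.proper ℝ V
    apply Metric.isCompact_of_isClosed_isBounded
    · have hc1 : Continuous fun q : V × V ↦ ⟪ε₀, q.1⟫ := continuous_const.inner continuous_fst
      have hc2 : Continuous fun q : V × V ↦ ‖q.1 - ⟪ε₀, q.1⟫ • ε₀‖ :=
        (continuous_fst.sub (hc1.smul continuous_const)).norm
      have hc3 : Continuous fun q : V × V ↦ ‖q.2‖ := continuous_snd.norm
      exact (isClosed_Icc.preimage hc1).inter
        ((isClosed_le hc2 continuous_const).inter (isClosed_le hc3 continuous_const))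
    · rw [Metric.isBounded_iff_subset_closedBall (0 : V × V)]
      refine ⟨max |a| |b| + δ₀ + 1, fun q hq ↦ ?_⟩
      rw [mem_closedBall, dist_zero_right, Prod.norm_def, max_le_iff]
      obtain ⟨h1, h2, h3⟩ := hq
      constructor
      · have e1 : q.1 = (q.1 - ⟪ε₀, q.1⟫ • ε₀) + ⟪ε₀, q.1⟫ • ε₀ := by abel
        have e2 : ‖⟪ε₀, q.1⟫ • ε₀‖ = |⟪ε₀, q.1⟫| := by rw [norm_smul, Real.norm_eq_abs, hε₀, mul_one]
        have e3 : |⟪ε₀, q.1⟫| ≤ max |a| |b| := abs_le_max_abs_abs h1.1 h1.2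
        calc ‖q.1‖ = ‖(q.1 - ⟪ε₀, q.1⟫ • ε₀) + ⟪ε₀, q.1⟫ • ε₀‖ := by rw [← e1]
          _ ≤ ‖q.1 - ⟪ε₀, q.1⟫ • ε₀‖ + ‖⟪ε₀, q.1⟫ • ε₀‖ := norm_add_le _ _
          _ ≤ δ₀ + max |a| |b| := by rw [e2]; exact add_le_add h2 e3
          _ ≤ max |a| |b| + δ₀ + 1 := by linarith
      · linarith [le_max_left |a| |b|, abs_nonneg a, hδ₀.le]
  set C' : Set (U × V) := {q | ⟪ε₀, (q.1 : V)⟫ ∈ Icc a b ∧ ‖(q.1 : V) - ⟪ε₀, (q.1 : V)⟫ • ε₀‖ ≤ δ₀ ∧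
    ‖q.2‖ ≤ 1} with hC'
  have hC'c : IsCompact C' := by
    have hemb : Topology.IsEmbedding (Prod.map ((↑) : U → V) (id : V → V)) :=
      Topology.IsEmbedding.subtypeVal.prodMap Topology.IsEmbedding.id
    rw [hemb.isCompact_iff]
    have himg : Prod.map ((↑) : U → V) (id : V → V) '' C' = C := by
      ext q
      constructor
      · rintro ⟨q', hq', rfl⟩
        exact hq'
      · intro hq
        exact ⟨(⟨q.1, hCsub q hq⟩, q.2), hq, rfl⟩
    rw [himg]
    exact hCc
  /- (2) uniform continuity -/
  have huc : UniformContinuousOn (fun q : U × V ↦ GU q.1 q.2 q.2) C' :=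
    hC'c.uniformContinuousOn_of_continuous hcont.continuousOn
  obtain ⟨δ₁, hδ₁, hδ₁f⟩ := Metric.uniformContinuousOn_iff.1 huc η hη
  refine ⟨min δ₀ δ₁, lt_min hδ₀ hδ₁, ?_⟩
  intro x hx hxr Y
  have hxδ₀ : ‖(x : V) - ⟪ε₀, (x : V)⟫ • ε₀‖ ≤ δ₀ := (hxr.trans_le (min_le_left _ _)).le
  have hxδ₁ : ‖(x : V) - ⟪ε₀, (x : V)⟫ • ε₀‖ < δ₁ := hxr.trans_le (min_le_right _ _)
  set x₁ : ℝ := ⟪ε₀, (x : V)⟫ with hx₁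
  have hyW : x₁ • ε₀ ∈ W := haxW x₁ hx
  set y : U := ⟨x₁ • ε₀, hWU hyW⟩ with hy
  -- on the axis the metric is the inner product
  have hax : expMap g.leviCivita (c ⟪ε₀, x₁ • ε₀⟫) (e ⟪ε₀, x₁ • ε₀⟫ (x₁ • ε₀ - ⟪ε₀, x₁ • ε₀⟫ • ε₀)) =
      c x₁ := tubeMap_axis (cov := g.leviCivita) (e := e) hε₀ x₁
  have haxis : ∀ Y' : V, GU y Y' Y' = ‖Y'‖ ^ 2 := by
    intro Y'
    have h := hGU (x₁ • ε₀) hyW Y' Y'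
    rw [val_congr_pt' g hax,
      val_mfderiv_tubeMap_axis (c := c) (e := e) (ε₀ := ε₀) g hgc hs hε₀ he₀ hiso x₁ Y' Y',
      real_inner_self_eq_norm_sq] at h
    exact h
  -- uniform continuity for `‖Y'‖ ≤ 1`
  have hnear : ∀ Y' : V, ‖Y'‖ ≤ 1 → |GU x Y' Y' - ‖Y'‖ ^ 2| < η := by
    intro Y' hY'
    have hq : (x, Y') ∈ C' := ⟨hx, hxδ₀, hY'⟩
    have hq' : (y, Y') ∈ C' := by
      refine ⟨?_, ?_, hY'⟩
      · show ⟪ε₀, x₁ • ε₀⟫ ∈ Icc a b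
        rw [inner_smul_unit_self hε₀]; exact hx
      · show ‖x₁ • ε₀ - ⟪ε₀, x₁ • ε₀⟫ • ε₀‖ ≤ δ₀
        rw [inner_smul_unit_self hε₀, sub_self, norm_zero]; exact hδ₀.le
    have hd : dist (x, Y') (y, Y') < δ₁ := by
      rw [Prod.dist_eq, dist_self, max_eq_left dist_nonneg, Subtype.dist_eq, dist_eq_norm]
      show ‖(x : V) - x₁ • ε₀‖ < δ₁
      exact hxδ₁
    have h := hδ₁f _ hq _ hq' hd
    rw [Real.dist_eq, haxis] at h
    exact h
  -- scaling
  by_cases hY0 : Y = 0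
  · subst hY0
    simp
  · have hYn : 0 < ‖Y‖ := norm_pos_iff.2 hY0
    set Y' : V := ‖Y‖⁻¹ • Y with hY'
    have hY'n : ‖Y'‖ = 1 := by
      rw [hY', norm_smul, norm_inv, norm_norm, inv_mul_cancel₀ hYn.ne']
    have hYdec : Y = ‖Y‖ • Y' := by
      rw [hY', smul_smul, mul_inv_cancel₀ hYn.ne', one_smul]
    have hsc : GU x Y Y = ‖Y‖ ^ 2 * GU x Y' Y' := by
      conv_lhs => rw [hYdec]
      rw [(GU (x : V)).map_smul₂, map_smul, smul_eq_mul, smul_eq_mul, sq, mul_assoc]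
    have h := hnear Y' hY'n.le
    rw [hY'n, one_pow, abs_lt] at h
    obtain ⟨h1, h2⟩ := h
    have hY2 : 0 ≤ ‖Y‖ ^ 2 := sq_nonneg _
    constructor
    · rw [hsc]
      have : (1 - η) ≤ GU x Y' Y' := by linarith
      calc (1 - η) * ‖Y‖ ^ 2 = ‖Y‖ ^ 2 * (1 - η) := by ring
        _ ≤ ‖Y‖ ^ 2 * GU x Y' Y' := mul_le_mul_of_nonneg_left this hY2
    · rw [hsc]
      have : GU x Y' Y' ≤ 1 + η := by linarith
      calc ‖Y‖ ^ 2 * GU x Y' Y' ≤ ‖Y‖ ^ 2 * (1 + η) := mul_le_mul_of_nonneg_left this hY2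
        _ = (1 + η) * ‖Y‖ ^ 2 := by ring

end Literature.Geometry.Riemannian

end
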